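import Summits.KontsevichZagierPeriods.KontsevichZagierPeriods.Theorems.LinRedNormalFormHoffmanSpanInKZSpanTransfer
import Summits.KontsevichZagierPeriods.KontsevichZagierPeriods.Theorems.MzvKernelInKZ.Negative.WeightsTwoThree
import Literature.NumberTheory.Transcendental.MultipleZetaValuesHoffmanProofs

/-!
# `HoffmanSpanInKZ` (stmt-KontsevichZagierPeriods-15044): negative side — which relation families of the line's certificates are load-bearing

Negative-side support for the crux `LinRedNormalForm.HoffmanSpanInKZ` and its picked line `Sketch`
(cdisprove unit; work file `Cruxes/HoffmanSpanInKZ/Disproof.lean`).  The line reduces the crux,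
sorry-free, to the per-weight certificates `EdsCertificate N` of `MzvKernelInKZTwoPosetsDefs`
(every admissible word = Hoffman words + finite double shuffle vectors `F` + Hoffman-relation
vectors `D` + duality vectors `K`, over `ℚ`).  Here: at weight `4` NEITHER `D` NOR `F` CAN BE
DROPPED — there is no certificate for `ζ(4)` with `D = []` (`no_certificate_four_without_hoffmanRel`)
nor with `F = []` (`no_certificate_four_without_fds`).  Method: a `ℚ`-linear functional `func wt`
on coefficient vectors given by weights on words, evaluated on the formal relation vectors
`fdsF`, `hoffmanF` of `MzvKernelInKZTwoPosetsEdsCertificateLow` by kernel `decide`, kills every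
allowed relation vector and the Hoffman unit vector but not `e_{ζ(4)}`; the finitely many allowed
indices are enumerated by the tree's `MZV.eq_of_isAdmissible_of_weight_eq_two/_three`,
`MZV.eq_of_isHoffman_of_weight_eq_four`.  (By exact rank, duality `K` IS dispensable for `3 ≤ N ≤ 11`, and the
full family has full rank for `N ≤ 14`: Disproof.lean §4–§5.)

Sources: K. Ihara, M. Kaneko, D. Zagier, Compos. Math. 142 (2006), §1 (finite double shuffle at
weight 4: `ζ(4) = 4ζ(3,1)` only); M. E. Hoffman, Pacific J. Math. 152 (1992), Thm 5.1. -/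

noncomputable section

namespace Summit.KontsevichZagierPeriods.HoffmanSpanInKZ.Negative

open Set
open Literature.NumberTheory.Transcendental
open Summit.KontsevichZagierPeriods.MzvKernelInKZ.Negative
open Summit.KontsevichZagierPeriods.MzvKernelInKZ.TwoPosets

/-! ## Linear functionals on coefficient vectors, evaluated on formal combinations -/

/-- The `ℚ`-linear functional on coefficient vectors of length-`N` words given by a weight on each
word: `v ↦ ∑_ε wt(ε) · v(ε)`. [folklore] -/
def func {N : ℕ} (wt : (Fin N → Bool) → ℚ) : Vec N →ₗ[ℚ] ℚ :=
  ∑ ε : Fin N → Bool, wt ε • LinearMap.proj ε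

/-- `func wt v = ∑_ε wt ε · v ε`. [folklore] -/
theorem func_apply {N : ℕ} (wt : (Fin N → Bool) → ℚ) (v : Vec N) :
    func wt v = ∑ ε, wt ε * v ε := by
  simp [func, LinearMap.sum_apply]

/-- `func wt` on a unit vector is the weight of the word. [folklore] -/
theorem func_unitVec {N : ℕ} (wt : (Fin N → Bool) → ℚ) (ε : Fin N → Bool) :
    func wt (unitVec N ε) = wt ε := by
  classical
  rw [func_apply, unitVec, Finset.sum_eq_single ε]
  · simp
  · intro ε' _ hne
    simp [Pi.single_eq_of_ne hne]
  · intro h; exact absurd (Finset.mem_univ ε) h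

/-- `func wt` on the realisation of a formal combination is computed letter by letter (the form in
which `decide` evaluates it). [folklore] -/
theorem func_eval {N : ℕ} (wt : (Fin N → Bool) → ℚ) (v : FVec) :
    func wt (FVec.eval N v) = (v.map fun p => p.2 * wt (wordOf N p.1)).sum := by
  induction v with
  | nil => simp
  | cons p v ih =>
    rw [FVec.eval_cons, map_add, map_smul, ih, func_unitVec, List.map_cons, List.sum_cons,
      smul_eq_mul]

/-- `func wt` on a finite double shuffle vector, as a list computation. [folklore] -/
theorem func_fdsVec {N : ℕ} (wt : (Fin N → Bool) → ℚ) (s t : List ℕ) :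
    func wt (fdsVec N s t) = ((fdsF s t).map fun p => p.2 * wt (wordOf N p.1)).sum := by
  rw [← eval_fdsF, func_eval]

/-- `func wt` on a Hoffman relation vector, as a list computation. [folklore] -/
theorem func_hoffmanVec {N : ℕ} (wt : (Fin N → Bool) → ℚ) (s : List ℕ) :
    func wt (hoffmanVec N s) = ((hoffmanF s).map fun p => p.2 * wt (wordOf N p.1)).sum := by
  rw [← eval_hoffmanF, func_eval]

/-- `func wt` kills a duality vector when the weight is duality-invariant at that word. [folklore] -/
theorem func_dualVec {N : ℕ} (wt : (Fin N → Bool) → ℚ) (ε : Fin N → Bool)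
    (h : wt ε = wt (dualWord ε)) : func wt (dualVec N ε) = 0 := by
  rw [dualVec, map_sub, func_unitVec, func_unitVec, h, sub_self]

/-- A list of scaled vectors all killed by a functional sums to `0` under it. [folklore] -/
theorem func_sum_eq_zero {N : ℕ} {α : Type*} (wt : (Fin N → Bool) → ℚ) (l : List α)
    (c : α → ℚ) (v : α → Vec N) (h : ∀ a ∈ l, func wt (v a) = 0) :
    func wt (l.map fun a => c a • v a).sum = 0 := by
  rw [map_list_sum, List.map_map]
  apply List.sum_eq_zero
  intro x hx
  obtain ⟨a, ha, rfl⟩ := List.mem_map.1 hx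
  simp [h a ha]

/-! ## Weight 4: Hoffman's relation is load-bearing, finite double shuffle is load-bearing -/

/-- Separating weights against FDS + duality + Hoffman units at weight `4`:
`0001, 0111 ↦ 4`, `0011 ↦ 1`, everything else (in particular the Hoffman word `0101`) `↦ 0`.
[folklore] -/
def wtH (ε : Fin 4 → Bool) : ℚ :=
  if ε = ![false, false, false, true] then 4 else
  if ε = ![false, false, true, true] then 1 else
  if ε = ![false, true, true, true] then 4 else 0

/-- Separating weights against Hoffman's relation + duality + Hoffman units at weight `4`: the
indicator of `ε ≠ 0101`. [folklore] -/
def wtF (ε : Fin 4 → Bool) : ℚ :=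
  if ε = ![false, true, false, true] then 0 else 1

/-- `wtH` at `ζ(4)` is `4`. [folklore] -/
theorem wtH_ω4 : wtH ω4 = 4 := by decide
/-- `wtF` at `ζ(4)` is `1`. [folklore] -/
theorem wtF_ω4 : wtF ω4 = 1 := by decide
/-- `wtH` kills the Hoffman word `0101`. [folklore] -/
theorem wtH_bword_two_two : wtH (bword 4 [2, 2]) = 0 := by decide
/-- `wtF` kills the Hoffman word `0101`. [folklore] -/
theorem wtF_bword_two_two : wtF (bword 4 [2, 2]) = 0 := by decide
/-- `wtH` is duality-invariant on admissible words. [folklore] -/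
theorem wtH_dual : ∀ ε : Fin 4 → Bool, Adm ε → wtH ε = wtH (dualWord ε) := by decide
/-- `wtF` is duality-invariant on admissible words. [folklore] -/
theorem wtF_dual : ∀ ε : Fin 4 → Bool, Adm ε → wtF ε = wtF (dualWord ε) := by decide
/-- `wtH` kills the finite double shuffle vector of `(2),(2)` (`4·1 − 4 = 0`; kernel `decide`). [folklore] -/
theorem wtH_fds_two_two : ((fdsF [2] [2]).map fun p => p.2 * wtH (wordOf 4 p.1)).sum = 0 := by
  decide +kernel
/-- `wtF` kills Hoffman's relation vector of `s = (3)` (`1 − 1 − 0`). [folklore] -/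
theorem wtF_hoffman_three : ((hoffmanF [3]).map fun p => p.2 * wtF (wordOf 4 p.1)).sum = 0 := by
  decide +kernel
/-- `wtF` kills Hoffman's relation vector of `s = (2,1)` (`1 + 0 − 1`). [folklore] -/
theorem wtF_hoffman_two_one :
    ((hoffmanF [2, 1]).map fun p => p.2 * wtF (wordOf 4 p.1)).sum = 0 := by
  decide +kernel

/-- **Hoffman's relation is load-bearing in the line at weight `4`.** There is NO certificate for
the word `ω₀ω₀ω₀ω₁` (`ζ(4)`) of the shape `EdsCertificate 4` with the Hoffman-relation list `D`
empty: finite double shuffle (the single pair `(2),(2)`: `4 e₀₀₁₁ − e₀₀₀₁`), duality and the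
Hoffman unit vector `e₀₁₀₁` are all killed by the functional `wtH`, which is `4` at `ζ(4)`.
(Value level: FDS gives only `ζ(4) = 4 ζ(3,1)`; the ratio `ζ(4) : ζ(2,2)` needs Hoffman's
relation `ζ(4) = ζ(3,1) + ζ(2,2)` or Euler's evaluation.) [folklore] -/
theorem no_certificate_four_without_hoffmanRel :
    ¬ ∃ (H : List (List ℕ × ℚ)) (F : List ((List ℕ × List ℕ) × ℚ)) (K : List ((Fin 4 → Bool) × ℚ)),
      (∀ p ∈ H, MZV.IsHoffman p.1 ∧ MZV.weight p.1 = 4) ∧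
      (∀ p ∈ F, MZV.IsAdmissible p.1.1 ∧ MZV.IsAdmissible p.1.2 ∧ p.1.1 ≠ [] ∧ p.1.2 ≠ [] ∧
        MZV.weight p.1.1 + MZV.weight p.1.2 = 4) ∧
      (∀ p ∈ K, Adm p.1) ∧
      unitVec 4 ω4 - (H.map fun p => p.2 • unitVec 4 (bword 4 p.1)).sum =
        (F.map fun p => p.2 • fdsVec 4 p.1.1 p.1.2).sum + (K.map fun p => p.2 • dualVec 4 p.1).sum := by
  rintro ⟨H, F, K, hH, hF, hK, heq⟩
  have h := congrArg (func wtH) heq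
  rw [map_sub, map_add, func_unitVec, wtH_ω4,
    func_sum_eq_zero wtH H (fun p => p.2) (fun p => unitVec 4 (bword 4 p.1)) ?_,
    func_sum_eq_zero wtH F (fun p => p.2) (fun p => fdsVec 4 p.1.1 p.1.2) ?_,
    func_sum_eq_zero wtH K (fun p => p.2) (fun p => dualVec 4 p.1) ?_] at h
  · norm_num at h
  · intro p hp
    exact func_dualVec wtH p.1 (wtH_dual p.1 (hK p hp))
  · intro p hp
    obtain ⟨h1, h2, h3, h4, h5⟩ := hF p hp
    have hw1 : 2 ≤ MZV.weight p.1.1 := MZV.two_le_weight_of_isAdmissible h1 h3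
    have hw2 : 2 ≤ MZV.weight p.1.2 := MZV.two_le_weight_of_isAdmissible h2 h4
    have e1 : p.1.1 = [2] := MZV.eq_of_isAdmissible_of_weight_eq_two h1 (by omega)
    have e2 : p.1.2 = [2] := MZV.eq_of_isAdmissible_of_weight_eq_two h2 (by omega)
    show func wtH (fdsVec 4 p.1.1 p.1.2) = 0
    rw [e1, e2, func_fdsVec, wtH_fds_two_two]
  · intro p hp
    obtain ⟨hu, hw⟩ := hH p hp
    show func wtH (unitVec 4 (bword 4 p.1)) = 0
    rw [func_unitVec, MZV.eq_of_isHoffman_of_weight_eq_four hu hw, wtH_bword_two_two]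

/-- **Finite double shuffle is load-bearing in the line at weight `4`.** There is NO certificate
for `ζ(4)` of the shape `EdsCertificate 4` with the FDS list `F` empty: Hoffman's relations
(`s = (3)`: `e₀₀₀₁ − e₀₀₁₁ − e₀₁₀₁`; `s = (2,1)`: `e₀₀₁₁ + e₀₁₀₁ − e₀₁₁₁`), duality and the Hoffman
unit vector are killed by the indicator `wtF` of `ε ≠ 0101`, which is `1` at `ζ(4)`. [folklore] -/
theorem no_certificate_four_without_fds :
    ¬ ∃ (H : List (List ℕ × ℚ)) (D : List (List ℕ × ℚ)) (K : List ((Fin 4 → Bool) × ℚ)),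
      (∀ p ∈ H, MZV.IsHoffman p.1 ∧ MZV.weight p.1 = 4) ∧
      (∀ p ∈ D, MZV.IsAdmissible p.1 ∧ MZV.weight p.1 + 1 = 4) ∧
      (∀ p ∈ K, Adm p.1) ∧
      unitVec 4 ω4 - (H.map fun p => p.2 • unitVec 4 (bword 4 p.1)).sum =
        (D.map fun p => p.2 • hoffmanVec 4 p.1).sum + (K.map fun p => p.2 • dualVec 4 p.1).sum := by
  rintro ⟨H, D, K, hH, hD, hK, heq⟩
  have h := congrArg (func wtF) heq
  rw [map_sub, map_add, func_unitVec, wtF_ω4,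
    func_sum_eq_zero wtF H (fun p => p.2) (fun p => unitVec 4 (bword 4 p.1)) ?_,
    func_sum_eq_zero wtF D (fun p => p.2) (fun p => hoffmanVec 4 p.1) ?_,
    func_sum_eq_zero wtF K (fun p => p.2) (fun p => dualVec 4 p.1) ?_] at h
  · norm_num at h
  · intro p hp
    exact func_dualVec wtF p.1 (wtF_dual p.1 (hK p hp))
  · intro p hp
    obtain ⟨h1, h2⟩ := hD p hp
    show func wtF (hoffmanVec 4 p.1) = 0
    rcases MZV.eq_of_isAdmissible_of_weight_eq_three h1 (by omega) with e | e
    · rw [e, func_hoffmanVec, wtF_hoffman_three]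
    · rw [e, func_hoffmanVec, wtF_hoffman_two_one]
  · intro p hp
    obtain ⟨hu, hw⟩ := hH p hp
    show func wtF (unitVec 4 (bword 4 p.1)) = 0
    rw [func_unitVec, MZV.eq_of_isHoffman_of_weight_eq_four hu hw, wtF_bword_two_two]

end Summit.KontsevichZagierPeriods.HoffmanSpanInKZ.Negative
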